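import Summits.NavierStokesRegularity.NavierStokesRegularity.Theses.TypeIIInviscidRelaxation
import Summits.NavierStokesRegularity.NavierStokesRegularity.Theorems.TypeIIInviscidRelaxationAxisymSwirlRegularZhangBarrier
import Summits.NavierStokesRegularity.NavierStokesRegularity.Theorems.TypeIIInviscidRelaxationAxisymSwirlRegularCoreStrainCriterion
import HarnessLib

/-!
# Line `parabolic_core_partial_typeI` for crux `OneSidedRadialCriterion` (stmt-NavierStokesRegularity-19059)

LINE-FIRST SKELETON (linewriter-ns-typeiiinviscid-1, g0).  The crux: an axisymmetric classical Leray–Hopf solution on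
`[0,T)` with the one-sided gate `r u_r ≥ -Cν` on an axis tube extends smoothly past `T` (any `C`; `C < 2` is the
tree theorem `ScenarioCensus.LogGate.oneSidedRadialCriterion_of_lt_two`, `C ≥ 2` is the content).

IDEA.  Zhang's partial Type I theorem (tree: `Theorems.hasSmoothExtensionPast_of_sqrtEnvelope`, arXiv:2604.07785
Thm 1.1 discharged in the tree) needs `u_r ≥ -M√ν/√(T-t)` on the unit tube `0 < r ≤ 1` for ALL `t ∈ [0,T)`.
The gate + tree theorems already supply this envelope everywhere EXCEPT in the viscous-parabolic core
`{0 < r < ξ√(ν(T-t))}` near `T`: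
* early slab `t ≤ T'`: `u` is bounded there (`hbd`), and `u_r ≥ -‖u‖`;
* off-core `r ≥ ξ√(ν(T-t))`: the unit-tube gate `u_r ≥ -νΛ₀/r` (tree:
  `RadialInflowCoreStrain.exists_unitTubeGate_of_tubeGate`, from the gate + the off-axis bound) gives
  `u_r ≥ -(Λ₀/ξ)√ν/√(T-t)`.
So the crux is EQUIVALENT (given the tree) to the research stub `stub_corePartialTypeI`: partial Type I for the radial
velocity INSIDE the parabolic core near `T`.  The two remaining stubs are the cover inequalities (assembly-grade,
tagged provable).

Registered stub: `stub_corePartialTypeI` [research, L].  The cover glue `offCore_envelope`, `earlySlab_envelope`,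
`envelope_mono` is PROVED here; the composition `OneSidedRadialCriterion_of` is sorry-free outside the stub.
A second entry door for provers (not a stub): a Type-I rate `u_r ≥ -κ r/(T-t)` for the one-sided radial STRAIN in the
parabolic core near `T` implies the stub (`r < ξ√(ν(T-t))` ⇒ `κ r/(T-t) < κξ√ν/√(T-t)`), cf. the all-times tree
version `RadialInflowCoreStrain.exists_coreWidth_strainRate`.
-/

namespace Summit.NavierStokesRegularity.NavierStokesRegularity.Cruxes.OneSidedRadialCriterion.ParabolicCorePartialTypeI

open Set Real
open Literature.Analysis.FluidPDE
open Summit.NavierStokesRegularity.NavierStokesRegularity.Theorems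
open Summit.NavierStokesRegularity.NavierStokesRegularity.Theorems.RadialInflowCoreStrain

/-- **stub_corePartialTypeI** [research, L — the whole content of the crux after localisation].
Under the crux's hypotheses (classical on `[0,T)`, Leray–Hopf, bounded on sub-slabs, axisymmetric slices, rapidly
decaying datum, gate `r u_r ≥ -Cν` on `{r < δ} × [0,T)`), the radial velocity obeys Zhang's partial Type I bound
`u_r ≥ -M√ν/√(T-t)` INSIDE the viscous-parabolic core `0 < r < ξ√(ν(T-t))` for `t ∈ [T',T)`, for some `ξ, M > 0`,
`0 ≤ T' < T`.  (Necessary: a solution smooth past `T` has `|u_r| ≤ G r ≤ Gξ√(ν(T-t))` there.)  Why it might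
fail: at `C ≥ 2` the drift–diffusion comparison gives no modulus for `Γ` at the axis (tree: `CriticalSink.not_uniform_modulus`),
and a focusing jet could carry `u_r ≈ -Cν/r` down to `r ∼ ν/‖u‖_∞ ≪ √(ν(T-t))` (Type II core), where
`Cν/r ≫ √ν/√(T-t)`.  Sources: arXiv:2604.07785 (Zhang 2026) Thm 1.1; KNSS2009 Thm 5.3; LeiZhang2017. -/
theorem stub_corePartialTypeI {ν T : ℝ} (hν : 0 < ν) (hT : 0 < T)
    {u : ℝ → EuclideanSpace ℝ (Fin 3) → EuclideanSpace ℝ (Fin 3)} {p : ℝ → EuclideanSpace ℝ (Fin 3) → ℝ}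
    (hcl : IsClassicalNSSolutionOn (Ico 0 T) ν 0 u p) (hLH : IsLerayHopfOn T ν 0 (u 0) u)
    (hbd : ∀ T' < T, ∃ M : ℝ, ∀ t ∈ Icc 0 T', ∀ x, ‖u t x‖ ≤ M)
    (hax : ∀ t ∈ Ico 0 T, IsAxisymmetric (u t)) (hdec : HasRapidSpatialDecay (u 0))
    (hin : ∃ C δ : ℝ, 0 < δ ∧ ∀ t ∈ Ico 0 T, ∀ x : EuclideanSpace ℝ (Fin 3), cylRadius x < δ →
      -(C * ν) ≤ x 0 * u t x 0 + x 1 * u t x 1) :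
    ∃ ξ M T' : ℝ, 0 < ξ ∧ 0 < M ∧ 0 ≤ T' ∧ T' < T ∧
      ∀ t ∈ Ico T' T, ∀ x : EuclideanSpace ℝ (Fin 3), 0 < cylRadius x → cylRadius x < ξ * √(ν * (T - t)) →
        -(M * √ν / √(T - t)) ≤ radialVelocity (u t) x := by
  sorry

/-- **offCore_envelope** [assembly glue, PROVED].  Outside the parabolic core the
unit-tube gate `-(νΛ₀/r)` dominates the `√`-envelope with constant `Λ₀/ξ`:
`ξ√(ν(T-t)) ≤ r`, `t < T` ⇒ `-((Λ₀/ξ)·√ν/√(T-t)) ≤ -(νΛ₀/r)`. -/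
theorem offCore_envelope {ν Λ₀ ξ T t r : ℝ} (hν : 0 < ν) (hΛ : 0 < Λ₀) (hξ : 0 < ξ) (ht : t < T)
    (hr : ξ * √(ν * (T - t)) ≤ r) :
    -(Λ₀ / ξ * √ν / √(T - t)) ≤ -(ν * Λ₀ / r) := by
  have hs : 0 < T - t := by linarith
  have hsT : 0 < √(T - t) := Real.sqrt_pos.2 hs
  obtain ⟨a, ha0, rfl⟩ : ∃ a : ℝ, 0 < a ∧ a ^ 2 = ν := ⟨√ν, Real.sqrt_pos.2 hν, Real.sq_sqrt hν.le⟩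
  rw [Real.sqrt_sq ha0.le]
  rw [Real.sqrt_mul (by positivity), Real.sqrt_sq ha0.le] at hr
  have hden : 0 < ξ * (a * √(T - t)) := by positivity
  have hr0 : 0 < r := lt_of_lt_of_le hden hr
  suffices h : a ^ 2 * Λ₀ / r ≤ Λ₀ / ξ * a / √(T - t) by linarith
  rw [div_le_div_iff₀ hr0 hsT]
  have h1 : Λ₀ / ξ * a * (ξ * (a * √(T - t))) ≤ Λ₀ / ξ * a * r :=
    mul_le_mul_of_nonneg_left hr (by positivity)
  have hξ0 : ξ ≠ 0 := hξ.ne'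
  have e : Λ₀ / ξ * a * (ξ * (a * √(T - t))) = a ^ 2 * Λ₀ * √(T - t) := by
    field_simp
  linarith

/-- **earlySlab_envelope** [assembly glue, PROVED].  On an early slab a plain bound
`-B ≤ u_r` dominates the `√`-envelope with constant `B√T/√ν` (any `B ≥ 0`):
`0 ≤ t < T` ⇒ `-((max B 0 * √T / √ν + 1) * √ν / √(T-t)) ≤ -B`. -/
theorem earlySlab_envelope {ν B T t : ℝ} (hν : 0 < ν) (hT : 0 < T) (ht0 : 0 ≤ t) (ht : t < T) :
    -((max B 0 * √T / √ν + 1) * √ν / √(T - t)) ≤ -B := by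
  have hs : 0 < T - t := by linarith
  have hsq : 0 < √(T - t) := Real.sqrt_pos.2 hs
  have hν' : 0 < √ν := Real.sqrt_pos.2 hν
  have hsT : √(T - t) ≤ √T := Real.sqrt_le_sqrt (by linarith)
  have h2 : B ≤ max B 0 := le_max_left _ _
  have h3 : max B 0 ≤ max B 0 * √T / √ν * √ν / √(T - t) := by
    rw [div_mul_cancel₀ _ hν'.ne', le_div_iff₀ hsq]
    exact mul_le_mul_of_nonneg_left hsT (le_max_right _ _)
  have h4 : max B 0 * √T / √ν * √ν / √(T - t) ≤ (max B 0 * √T / √ν + 1) * √ν / √(T - t) := by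
    apply div_le_div_of_nonneg_right _ hsq.le
    apply mul_le_mul_of_nonneg_right _ hν'.le
    linarith
  linarith

/-- Monotonicity of the envelope in the constant: `M ≤ M'` ⇒ `-(M'√ν/√(T-t)) ≤ -(M√ν/√(T-t))`. -/
theorem envelope_mono {ν T t M M' : ℝ} (hMM : M ≤ M') :
    -(M' * √ν / √(T - t)) ≤ -(M * √ν / √(T - t)) := by
  have h1 : 0 ≤ √ν / √(T - t) := div_nonneg (Real.sqrt_nonneg _) (Real.sqrt_nonneg _)
  have : M * √ν / √(T - t) ≤ M' * √ν / √(T - t) := by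
    rw [mul_div_assoc, mul_div_assoc]
    exact mul_le_mul_of_nonneg_right hMM h1
  linarith

/-- **Composition (sorry-free): the line closes the crux BY NAME.** -/
theorem OneSidedRadialCriterion_of :
    Summit.NavierStokesRegularity.NavierStokesRegularity.Theses.TypeIIInviscidRelaxation.OneSidedRadialCriterion := by
  intro ν T hν hT u p hcl hLH hbd hax hdec hin
  -- (1) research stub: the envelope inside the parabolic core near `T`
  obtain ⟨ξ, M₁, T', hξ, hM₁, hT'0, hT'T, hcore⟩ := stub_corePartialTypeI hν hT hcl hLH hbd hax hdec hin
  -- (2) tree: the unit-tube gate `u_r ≥ -νΛ₀/r` on `0 < r ≤ 1`, all `t ∈ [0,T)`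
  obtain ⟨Λ₀, hΛ₀, hgate⟩ := exists_unitTubeGate_of_tubeGate hν hT hcl hLH hbd hax hdec hin
  -- (3) the early slab bound
  obtain ⟨B, hB⟩ := hbd T' hT'T
  -- the envelope constant
  set M : ℝ := max M₁ (max (Λ₀ / ξ) (max B 0 * √T / √ν + 1)) with hM_def
  have hM₁M : M₁ ≤ M := le_max_left _ _
  have hΛM : Λ₀ / ξ ≤ M := (le_max_left _ _).trans (le_max_right _ _)
  have hBM : max B 0 * √T / √ν + 1 ≤ M := (le_max_right _ _).trans (le_max_right _ _)
  have hM : 0 < M := lt_of_lt_of_le hM₁ hM₁M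
  refine hasSmoothExtensionPast_of_sqrtEnvelope hν hM hT hcl hLH hdec hax ?_
  intro t ht x hx0 hx1
  by_cases htT' : t ≤ T'
  · -- early slab: `u_r ≥ -‖u‖ ≥ -B`
    have hux : ‖u t x‖ ≤ B := hB t ⟨ht.1, htT'⟩ x
    have h1 : -B ≤ radialVelocity (u t) x :=
      le_trans (by linarith) (neg_norm_le_radialVelocity (u t) x)
    exact le_trans (le_trans (envelope_mono hBM) (earlySlab_envelope (B := B) hν hT ht.1 ht.2)) h1
  · push Not at htT'
    have ht' : t ∈ Ico T' T := ⟨htT'.le, ht.2⟩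
    by_cases hcr : cylRadius x < ξ * √(ν * (T - t))
    · -- inside the parabolic core: the research stub
      exact le_trans (envelope_mono hM₁M) (hcore t ht' x hx0 hcr)
    · -- off-core: the unit-tube gate
      push Not at hcr
      exact le_trans (le_trans (envelope_mono hΛM) (offCore_envelope hν hΛ₀ hξ ht.2 hcr))
        (hgate t ht x hx0 hx1)

end Summit.NavierStokesRegularity.NavierStokesRegularity.Cruxes.OneSidedRadialCriterion.ParabolicCorePartialTypeI
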